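import Literature.NumberTheory.ConnesConsani2021.ArchimedeanTraceFormulaProofs
import Literature.NumberTheory.ConnesConsani2021.QuantizedDiffInfiniteOrderIff
import Literature.NumberTheory.ConnesConsani2021.FrequencyKernelSeparableApprox
import HarnessLib

/-!
# `[H, f]` is an infinitesimal of infinite order: discharge of `CC2021_lemma_D47`
# (Connes–Consani 2021, App. D Lemma D.1 = arXiv Lemma 47)

RH-FREE analysis (cell `rh-crit`, sub-cell cc; App. D is OFF the leaf path of the cc corpus).  This file
DISCHARGES the tree's named fact `Literature.NumberTheory.ConnesConsani2021.CC2021_lemma_D47`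
(`ArchimedeanTraceFormula.lean`): "for `f ∈ 𝒮(Ĉ)` the quantized differential `[H, f]` is an infinitesimal
of infinite order (and in particular a trace class operator)", typed on the printed kernel
`k_f(s,t) = (i/π)(f(s) − f(t))/(s − t)` in the kernel-operator idiom.  It is the two-line assembly of

* `CC2021_lemma_D47_iff_isInfiniteOrder` (`ArchimedeanTraceFormulaProofs`): the fact is equivalent to
  "every bounded operator on `L²(ℝ)` acting a.e. by the kernel `k_f` is of infinite order" (the
  square-integrability clause is `memLp_quantizedDiffKernel`);
* `isInfiniteOrder_quantizedDiff_of_frequencyKernelApprox` (`QuantizedDiffInfiniteOrderIff`): that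
  statement follows from a super-polynomial separable `L²(ℝ²)`-approximation of the frequency kernel
  `−2 f̂(ξ−η)(1_{ξ>0≥η} − 1_{ξ≤0<η})` of `[H, f]` (Fourier conjugation `QuantizedDiffFourierSide`,
  approximation numbers of kernel operators `KernelApproxNumberBound`);
* `frequencyKernel_separableApprox` (`FrequencyKernelSeparableApprox`): that approximation, i.e. the
  "direct kernel estimate" of App. D Rem. 48 made quantitative (box-Taylor pieces, bricks of
  `FrequencyKernelApproxPieces`).

So the tree now PROVES Lemma 47 along the third road of Rem. 48 (the printed proof via the harmonic
oscillator `A = −∂² + x²` and the conformal-map proof are not formalised).  Net debt −1.  WHAT THIS IS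
NOT: any claim about RH — nothing here bears on the truth of RH.

## References

* A. Connes, C. Consani, *Weil positivity and trace formula, the archimedean place*, Selecta Math. (N.S.)
  27 (2021) 77 = arXiv:2006.13771, App. D Lemma D.1 (= arXiv Lemma 47) and Remark D.2 (= Rem. 48),
  p. 33 (held chunk p0033:L22–41). [`ConnesConsani2021`]
* A. Connes, *Noncommutative Geometry* (1994), Chap. IV §2.α (infinitesimals of infinite order).
  [`Connes1994`]
-/

noncomputable section

open MeasureTheory

namespace Literature.NumberTheory.ConnesConsani2021

/-- RH-FREE. **Connes–Consani 2021, App. D Lemma D.1 (= arXiv Lemma 47), DISCHARGED:** for every Schwartz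
function `f` the kernel `k_f(s,t) = (i/π)(f(s) − f(t))/(s − t)` of the quantized differential `[H, f]` is
square integrable on `ℝ²` and every bounded operator on `L²(ℝ)` acting a.e. by it is an infinitesimal of
infinite order (`IsInfiniteOrder`).  Proof = `CC2021_lemma_D47_iff_isInfiniteOrder` +
`isInfiniteOrder_quantizedDiff_of_frequencyKernelApprox` + `frequencyKernel_separableApprox` (the direct
kernel estimate of Rem. 48).
[cite: ConnesConsani2021, App. D Lemma D.1 p. 33 (= arXiv:2006.13771 Lemma 47, chunk p0033:L22–41; proof road of Rem. D.2 = Rem. 48, L39–41)] -/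
theorem CC2021_lemma_D47_holds : CC2021_lemma_D47 :=
  CC2021_lemma_D47_iff_isInfiniteOrder.2 fun f A hA =>
    isInfiniteOrder_quantizedDiff_of_frequencyKernelApprox frequencyKernel_separableApprox f A hA

/-- RH-FREE. "… and in particular a trace class operator" (Lemma D.1 (47), second clause), now
UNCONDITIONAL: every bounded operator on `L²(ℝ)` acting a.e. by the kernel of `[H, f]` (`f` Schwartz) is
trace class. [cite: ConnesConsani2021, App. D Lemma D.1 p. 33 (= arXiv Lemma 47, chunk p0033:L22)] -/
theorem quantizedDiff_isTraceClass (f : SchwartzMap ℝ ℂ)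
    (A : Lp ℂ 2 (volume : Measure ℝ) →L[ℂ] Lp ℂ 2 (volume : Measure ℝ))
    (hA : ∀ φ : Lp ℂ 2 (volume : Measure ℝ),
      (A φ : ℝ → ℂ) =ᵐ[volume] fun s => ∫ t, quantizedDiffKernel f s t * (φ : ℝ → ℂ) t) :
    IsTraceClass A :=
  CC2021_lemma_D47_holds.isTraceClass f A hA

/-- RH-FREE. The first clause unconditionally, in operator form: every bounded operator on `L²(ℝ)` acting
a.e. by the kernel of `[H, f]` (`f` Schwartz) is an infinitesimal of infinite order.
[cite: ConnesConsani2021, App. D Lemma D.1 p. 33 (= arXiv Lemma 47, chunk p0033:L22)] -/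
theorem quantizedDiff_isInfiniteOrder (f : SchwartzMap ℝ ℂ)
    (A : Lp ℂ 2 (volume : Measure ℝ) →L[ℂ] Lp ℂ 2 (volume : Measure ℝ))
    (hA : ∀ φ : Lp ℂ 2 (volume : Measure ℝ),
      (A φ : ℝ → ℂ) =ᵐ[volume] fun s => ∫ t, quantizedDiffKernel f s t * (φ : ℝ → ℂ) t) :
    IsInfiniteOrder A :=
  (CC2021_lemma_D47_holds f).2 A hA

end Literature.NumberTheory.ConnesConsani2021
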